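import Summits.HodgeConjecture.CorCM.Census.CentralSquaresMixedFrameLaw
import Summits.HodgeConjecture.CorCM.Census.CentralSquaresDihedralOrderFour
import Summits.HodgeConjecture.CorCM.Census.CentralSquaresDihedralFrame

/-!
# The square-central class, XLV: THE DIHEDRAL LAW — `μ(G, c) = φ₂(G, c) = β(G, c) − 2` for EVERY dihedral quotient of a `2`-group

COR-CM (cell `pub-hodgecm2`), count-neutral kernel combinatorics by the binder seat b09 (gen 48; lane SQUARE-CENTRAL CLASS, part XLV), the instance of part XLIVʼs
mixed-face frame law, on part XXXIXʼs dihedral datum (`dq_base`, `dq_card`, `dq_card_H`, `dq_Hset`, `dq_Hcset`, `dq_swap`, `dq_sigma_H`, `dq_transversal_H/Hc`),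
part XXXIIʼs `D₄` facts (`dihedral_Phi`, `dihedral_Phi_stab`, `dihedral_sr_T₁`) and part XIʼs `fibreTwo_add_two_eq_card_block_of_dihedral_quotient'` BY NAME.
Theorems only: no definition, no certificate, no named fact, no `sorry`; `decide` only on `DihedralGroup 4`.  HONEST FRAMING: `HC_CM` is NOT proved, here or
anywhere in the tree; nothing here is a period or a headline — these are census laws `μ(G, c)` for the face-relation lattice.

**`isLeast_card_gfaces_generate_of_dihedral`** (THE DIHEDRAL LAW): `G` a finite `2`-group, `c` a central involution, `π : G ↠ D₄` with `π c = r²` and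
`|ker π| ≥ 2` ⟹ **`μ(G, c) = φ₂(G, c)`**; `…_block`: **`= β(G, c) − 2`**.  NO hypothesis on the kernel or on the reflection lifts: this contains parts X
(involutive lift of `s`, `|ker π| ≥ 4`), XXII/XXXII/XXXIII (`|ker π| = 2`), XL (`|ker π| = 4` with a reflection lift of order dividing `4`) and closes
the last open dihedral-quotient rows of order `32` (`ℤ/4 ⋊ ℤ/8` with `c = ρ²` or `c = ρ²q⁴`, every reflection lift of order `8`) together with all
dihedral quotients of order `64, 128, …`; **`…_of_dihedral_kernel_four'`**: `|ker π| = 4` ⟹ `μ = φ₂ = β − 2` unconditionally.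

THE DATUM (`m = |ker π|`).  `T₀ = π⁻¹{1, r, s, sr}`, `T₁ = T₀·q⁻¹` for a lift `q` of `s` (base-involutive swap), `𝓗 = π⁻¹{r, sr}`, `𝓗ᶜ = π⁻¹{1, s}`;
transversals `T = π⁻¹(r)`, `A = π⁻¹(s)`; the designated type `Φ = {T ∣ A} = π⁻¹{1, r³, sr, sr²}` with `Stab Φ = π⁻¹{1, sr}`; the mixed face at `q ∈ A`
and `g₁ ∈ 𝓗 ∖ T = π⁻¹(sr)` (`g₁` any lift of `sr`: `T₀·g₁⁻¹ = T₀`, `T₁·g₁⁻¹ = T̄₁`, `Φ·g₁⁻¹ = Φ`); prescriptions at `Φ^{(q)}` (places `g₁, g₁u₀`) and at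
`Φ^{(g₁)}` (places `1, u₀`), `u₀ ∈ ker π ∖ 1`; KERNEL MOVERS = `ker π` (transitive on every fibre: `x = g₁·u⁻¹` with `u = x⁻¹g₁` for `π x = sr`,
`y = u⁻¹` for `π y = 1`).  The two tie blocks are distinct because the sets of FULL fibres differ: `{d ∣ π⁻¹(d) ⊆ Φ^{(q)}} = {1, r³, sr}` and
`{d ∣ π⁻¹(d) ⊆ Φ^{(g₁)}} = {1, r³, sr²}` are not right translates of each other in `D₄` (`dihedral_full_fibres_ne`, `decide`).

NUMERICS (gen 48, first-hand, job j249070): in all 246 four-type frames of order 16 and 32 checked (every `(G, K, c)` with `G/K ≅ D₄`, `|K| = 4`, both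
reflection classes; and the order-16 rows) the mixed face with its `Stab Φ`-translates closes the residual lattice with Smith invariants `[m, 2m]`.

## References
* [Pohlmann1968] H. Pohlmann, Algebraic cycles on abelian varieties of complex multiplication type, Ann. of Math. 88 (1968), Thm 1.
* [Milne1999] J. S. Milne, Lefschetz motives and the Tate conjecture, Compositio Math. 117 (1999), Prop. 2.1, p. 54.
-/

namespace Summit.HodgeConjecture.CorCM.Census.CentralSquares

open Finset DihedralGroup
open Summit.HodgeConjecture.CorCM.Prior.AllgGroup.RfwfAllgGroup
open Summit.HodgeConjecture.CorCM.Census.BlockParity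
open Summit.HodgeConjecture.CorCM.Census.Coinvariant
open Summit.HodgeConjecture.CorCM.Census.TwistGeneration
open Summit.HodgeConjecture.CorCM.Census.BaseBlock
open Summit.HodgeConjecture.CorCM.Census.CoverClosure

noncomputable section

variable {G : Type*} [Group G] [Fintype G] [DecidableEq G]

/-! ## §1 Facts about `D₄` -/

/-- The sets of full fibres of the two tie corners, `{1, r³, sr}` and `{1, r³, sr²}`, are not right translates of each other. [folklore] -/
theorem dihedral_full_fibres_ne : ∀ e : DihedralGroup 4,
    ¬ (∀ d : DihedralGroup 4, d * e ∈ ({r 0, r 3, sr 1} : Finset (DihedralGroup 4)) ↔ d ∈ ({r 0, r 3, sr 2} : Finset (DihedralGroup 4))) := by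
  decide

/-- Case split of `D₄` adapted to the corner `Φ^{(g₁)}`: full fibres, the flipped fibre `sr`, its partner `sr³`, or outside. [folklore] -/
theorem dihedral_cases_h : ∀ d : DihedralGroup 4, d ∈ ({r 0, r 3, sr 2} : Finset (DihedralGroup 4)) ∨ d = sr 1 ∨ d = sr 3 ∨
    (d ∉ ({r 0, r 3, sr 1, sr 2} : Finset (DihedralGroup 4)) ∧ d ≠ sr 3) := by decide

/-- Case split of `D₄` adapted to the corner `Φ^{(q)}`: full fibres, the flipped fibre `sr²`, its partner `s`, or outside. [folklore] -/
theorem dihedral_cases_q : ∀ d : DihedralGroup 4, d ∈ ({r 0, r 3, sr 1} : Finset (DihedralGroup 4)) ∨ d = sr 2 ∨ d = sr 0 ∨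
    (d ∉ ({r 0, r 3, sr 1, sr 2} : Finset (DihedralGroup 4)) ∧ d ≠ sr 0) := by decide

/-! ## §2 The dihedral law -/

/-- **THE DIHEDRAL LAW.**  `G` a finite `2`-group, `c` a central involution, `π : G →* D₄` surjective with `π c = r²` and `|ker π| ≥ 2`:
**`μ(G, c) = φ₂(G, c)`** — no hypothesis on the kernel or on the reflection lifts. [folklore] -/
theorem isLeast_card_gfaces_generate_of_dihedral {c : G} (hG : IsPGroup 2 G) (hc2 : c * c = 1) (hcen : ∀ x : G, x * c = c * x)
    (π : G →* DihedralGroup 4) (hπ : Function.Surjective π) (hπc : π c = r 2) (hker : 2 ≤ Nat.card π.ker) :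
    IsLeast {n : ℕ | ∃ S : Finset (CMF G c →₀ ℤ), (↑S ⊆ gfaceSet G c hc2) ∧ S.card = n ∧
      hodgeSpan c hc2 ≤ Submodule.span ℤ (pairSet c) ⊔ Submodule.span ℤ (translates c S)} (fibreTwo c hc2) := by
  classical
  have hc1 : c ≠ 1 := by
    intro h; rw [h, map_one] at hπc; exact absurd hπc (by decide)
  -- the kernel: its order `m = 2ʲ ≥ 2`, a nontrivial element `u₀`
  set m : ℕ := Nat.card π.ker with hmdef
  obtain ⟨j, hj⟩ := IsPGroup.iff_card.mp (hG.to_subgroup π.ker)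
  have hkm : (2 : ℤ) ^ (j + 1) = 2 * (m : ℤ) := by rw [pow_succ, hmdef, hj]; push_cast; ring
  have hnt : Nontrivial π.ker := Finite.one_lt_card_iff_nontrivial.mp (by omega)
  obtain ⟨⟨u₀, hu₀K⟩, hu₀1'⟩ := exists_ne (1 : π.ker)
  have hu₀ : π u₀ = 1 := MonoidHom.mem_ker.mp hu₀K
  have hu₀1 : u₀ ≠ 1 := fun h => hu₀1' (Subtype.ext h)
  -- the base type, the swap `q` over `s`, the frame
  obtain ⟨q, hq⟩ := hπ (sr 0)
  obtain ⟨g₁, hg₁⟩ := hπ (sr 1)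
  let T₀ : CMF G c := ⟨univ.filter fun g : G => π g ∈ ({r 0, r 1, sr 0, sr 1} : Finset (DihedralGroup 4)), isCMF_comap π hπc⟩
  have hT₀ : ∀ P : G, P ∈ T₀.1 ↔ π P ∈ ({r 0, r 1, sr 0, sr 1} : Finset (DihedralGroup 4)) := fun P => by
    change P ∈ univ.filter (fun g : G => π g ∈ ({r 0, r 1, sr 0, sr 1} : Finset (DihedralGroup 4))) ↔ _
    rw [mem_filter]; simp only [mem_univ, true_and]
  have hn : T₀.1.card = 4 * m := dq_card π hπ T₀ hT₀
  have hH : (T₀.1 \ (rt c q T₀).1).card = 2 * m := dq_card_H π hπ T₀ hT₀ q hq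
  have hQ₁ : rt c q (rt c q T₀) = T₀ := (dq_swap π T₀ hT₀ q hq q hq).2
  have hσH := dq_sigma_H π hπc T₀ hT₀ q hq q hq
  have hm2 : 2 ≤ m := hker
  -- kernel elements stabilise `T₀` and `T₁`
  have hrtK : ∀ g : G, π g = 1 → rt c g T₀ = T₀ := fun g hg =>
    Subtype.ext (Finset.ext fun P => by rw [dq_rt_mem π T₀ hT₀, hg, mul_one, hT₀])
  have hrtK₁ : ∀ g : G, π g = 1 → rt c g (rt c q T₀) = rt c q T₀ := fun g hg => by
    rw [← rt_mul]; exact (dq_swap π T₀ hT₀ q hq (g * q) (by rw [map_mul, hg, hq, one_mul])).1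
  -- fibre membership in the two halves
  have hHmem : ∀ P : G, P ∈ T₀.1 \ (rt c q T₀).1 ↔ π P ∈ ({r 1, sr 1} : Finset (DihedralGroup 4)) := fun P => by
    rw [dq_Hset π T₀ hT₀ q hq, mem_filter]; simp only [mem_univ, true_and]
  have hHcmem : ∀ P : G, P ∈ T₀.1 ∩ (rt c q T₀).1 ↔ π P ∈ ({r 0, sr 0} : Finset (DihedralGroup 4)) := fun P => by
    rw [dq_Hcset π T₀ hT₀ q hq, mem_filter]; simp only [mem_univ, true_and]
  -- the transversals `T = π⁻¹(r)`, `A = π⁻¹(s)`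
  set T : Finset G := univ.filter fun g : G => π g = r 1 with hTdef
  set A : Finset G := univ.filter fun g : G => π g = sr 0 with hAdef
  have hTmem : ∀ P : G, P ∈ T ↔ π P = r 1 := fun P => by rw [hTdef, mem_filter]; simp only [mem_univ, true_and]
  have hAmem : ∀ P : G, P ∈ A ↔ π P = sr 0 := fun P => by rw [hAdef, mem_filter]; simp only [mem_univ, true_and]
  obtain ⟨hTH, hTm, hTt⟩ := dq_transversal_H π hπ hπc T₀ hT₀ q hq q hq (r 1) (by decide)
  obtain ⟨hAH, hAm, hAt⟩ := dq_transversal_Hc π hπ hπc T₀ hT₀ q hq q hq (sr 0) (by decide)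
  have hT'mem : ∀ P : G, P ∈ (T₀.1 \ (rt c q T₀).1) \ T ↔ π P = sr 1 := fun P => by
    rw [mem_sdiff, hHmem, hTmem, mem_insert, mem_singleton]
    constructor
    · rintro ⟨h1 | h1, h2⟩
      · exact absurd h1 h2
      · exact h1
    · intro h1; refine ⟨Or.inr h1, ?_⟩; rw [h1]; decide
  have hA'mem : ∀ P : G, P ∈ (T₀.1 ∩ (rt c q T₀).1) \ A ↔ π P = 1 := fun P => by
    rw [mem_sdiff, hHcmem, hAmem, mem_insert, mem_singleton]
    constructor
    · rintro ⟨h1 | h1, h2⟩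
      · rw [h1]; decide
      · exact absurd h1 h2
    · intro h1; rw [h1]; decide
  -- the designated type `Φ = π⁻¹{1, r³, sr, sr²}`
  obtain ⟨Φ, hΦ⟩ := exists_type_of_dev c hc2 T₀ (T ∪ A) (union_subset (hTH.trans sdiff_subset) (hAH.trans inter_subset_left))
  have hΦmem : ∀ P : G, P ∈ Φ.1 ↔ π P ∈ ({r 0, r 3, sr 1, sr 2} : Finset (DihedralGroup 4)) := by
    intro P
    by_cases hP0 : P ∈ T₀.1
    · have e : P ∈ Φ.1 ↔ P ∉ T₀.1 \ Φ.1 := by rw [mem_sdiff]; tauto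
      rw [e, hΦ, mem_union, hTmem, hAmem]
      rw [hT₀] at hP0
      exact (dihedral_Phi (π P)).1 hP0
    · have hcP : c * P ∈ T₀.1 := by by_contra h'; exact hP0 ((T₀.2 P).mpr h')
      have e : P ∈ Φ.1 ↔ c * P ∈ T₀.1 \ Φ.1 := by rw [mem_sdiff, Φ.2 P]; tauto
      rw [e, hΦ, mem_union, hTmem, hAmem, map_mul, hπc]
      rw [hT₀] at hP0
      exact (dihedral_Phi (π P)).2 hP0
  have hrtKΦ : ∀ g : G, π g = 1 → rt c g Φ = Φ := fun g hg =>
    Subtype.ext (Finset.ext fun P => by rw [mem_rt, hΦmem, hΦmem, map_mul, hg, mul_one])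
  -- the lift `g₁` of `sr`
  have hg₁T₀ : rt c g₁ T₀ = T₀ :=
    Subtype.ext (Finset.ext fun P => by rw [dq_rt_mem π T₀ hT₀, hg₁, hT₀]; exact dihedral_stab_sr (π P))
  have hg₁T₁ : rt c g₁ (rt c q T₀) = rt c c (rt c q T₀) := by
    apply Subtype.ext; ext P
    rw [← rt_mul, ← rt_mul, dq_rt_mem π T₀ hT₀, dq_rt_mem π T₀ hT₀, map_mul, map_mul, hg₁, hq, hπc]
    exact dihedral_sr_T₁ (π P)
  have hgΦ : rt c g₁ Φ = Φ := by
    apply Subtype.ext; ext P; rw [mem_rt, hΦmem, hΦmem, map_mul, hg₁]; exact dihedral_Phi_stab (π P)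
  -- the places of the three faces
  have hqA : q ∈ A := (hAmem q).mpr hq
  have hh : g₁ ∈ (T₀.1 \ (rt c q T₀).1) \ T := (hT'mem g₁).mpr hg₁
  have hh₂ : g₁ * u₀ ∈ (T₀.1 \ (rt c q T₀).1) \ T := (hT'mem _).mpr (by rw [map_mul, hg₁, hu₀, mul_one])
  have hhh₂ : g₁ ≠ g₁ * u₀ := fun h => hu₀1 (mul_eq_left.mp h.symm)
  have hκ₂ : u₀ ∈ (T₀.1 ∩ (rt c q T₀).1) \ A := (hA'mem u₀).mpr hu₀
  have hκ₁₂ : g₁ * g₁⁻¹ ≠ u₀ := by rw [mul_inv_cancel]; exact hu₀1.symm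
  -- the kernel movers
  have hTex : ∀ x ∈ (T₀.1 \ (rt c q T₀).1) \ T, ∃ u : G, rt c u T₀ = T₀ ∧ rt c u (rt c q T₀) = rt c q T₀ ∧ rt c u Φ = Φ ∧ x = g₁ * u⁻¹ := by
    intro x hx
    have hπx : π x = sr 1 := (hT'mem x).mp hx
    have hu : π (x⁻¹ * g₁) = 1 := by rw [map_mul, map_inv, hπx, hg₁]; decide
    exact ⟨x⁻¹ * g₁, hrtK _ hu, hrtK₁ _ hu, hrtKΦ _ hu, by rw [mul_inv_rev, inv_inv, mul_inv_cancel_left]⟩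
  have hAex : ∀ y ∈ (T₀.1 ∩ (rt c q T₀).1) \ A, ∃ u : G, rt c u T₀ = T₀ ∧ rt c u (rt c q T₀) = rt c q T₀ ∧ rt c u Φ = Φ ∧
      y = g₁ * g₁⁻¹ * u⁻¹ := by
    intro y hy
    have hπy : π y = 1 := (hA'mem y).mp hy
    have hu : π y⁻¹ = 1 := by rw [map_inv, hπy, inv_one]
    exact ⟨y⁻¹, hrtK _ hu, hrtK₁ _ hu, hrtKΦ _ hu, by rw [mul_inv_cancel, one_mul, inv_inv]⟩
  -- the two tie blocks are distinct: full fibres `{1, r³, sr}` of `Φ^{(q)}` versus `{1, r³, sr²}` of `Φ^{(g₁)}`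
  have hmemq : ∀ y : G, y ∈ (oflipCM c hc2 q Φ).1 ↔
      ¬ (π y ∈ ({r 0, r 3, sr 1, sr 2} : Finset (DihedralGroup 4)) ↔ (y = q ∨ y = c * q)) := fun y => by
    rw [mem_oflipCM_iff', hΦmem, mem_orb]
  have hmemg : ∀ y : G, y ∈ (oflipCM c hc2 g₁ Φ).1 ↔
      ¬ (π y ∈ ({r 0, r 3, sr 1, sr 2} : Finset (DihedralGroup 4)) ↔ (y = g₁ ∨ y = c * g₁)) := fun y => by
    rw [mem_oflipCM_iff', hΦmem, mem_orb]
  have hπne : ∀ {x y : G}, π x ≠ π y → x ≠ y := fun h e => h (by rw [e])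
  have hFFq : ∀ d : DihedralGroup 4, (∀ P : G, π P = d → P ∈ (oflipCM c hc2 q Φ).1) ↔ d ∈ ({r 0, r 3, sr 1} : Finset (DihedralGroup 4)) := by
    intro d
    constructor
    · intro hall
      rcases dihedral_cases_q d with hd | hd | hd | ⟨hd, hd'⟩
      · exact hd
      · exfalso
        have h1 := (hmemq (c * q)).mp (hall (c * q) (by rw [map_mul, hπc, hq, hd]; decide))
        apply h1
        constructor
        · intro _; exact Or.inr rfl
        · intro _; rw [map_mul, hπc, hq]; decide
      · exfalso
        have h1 := (hmemq (q * u₀)).mp (hall (q * u₀) (by rw [map_mul, hq, hu₀, mul_one, hd]))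
        apply h1
        constructor
        · intro h'; rw [map_mul, hq, hu₀, mul_one] at h'; exact absurd h' (by decide)
        · rintro (h' | h')
          · exact absurd (mul_eq_left.mp h') hu₀1
          · exfalso
            have e : π (q * u₀) = π (c * q) := by rw [h']
            rw [map_mul, map_mul, hq, hu₀, hπc] at e; exact absurd e (by decide)
      · exfalso
        obtain ⟨P, hP⟩ := hπ d
        have h1 := (hmemq P).mp (hall P hP)
        apply h1
        constructor
        · intro h'; rw [hP] at h'; exact absurd h' hd
        · rintro (h' | h')
          · rw [h', hq] at hP; exact absurd hP.symm hd'
          · rw [h', map_mul, hπc, hq] at hP; rw [← hP] at hd; exact absurd (by decide) hd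
    · intro hd P hP
      rw [hmemq]
      intro h'
      have h1 : π P ∈ ({r 0, r 3, sr 1, sr 2} : Finset (DihedralGroup 4)) := by
        rw [hP]
        exact (by decide : ∀ e : DihedralGroup 4, e ∈ ({r 0, r 3, sr 1} : Finset (DihedralGroup 4)) →
          e ∈ ({r 0, r 3, sr 1, sr 2} : Finset (DihedralGroup 4))) d hd
      rcases h'.mp h1 with h2 | h2
      · rw [h2, hq] at hP; rw [← hP] at hd; exact absurd hd (by decide)
      · rw [h2, map_mul, hπc, hq] at hP; rw [← hP] at hd; exact absurd hd (by decide)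
  have hFFg : ∀ d : DihedralGroup 4, (∀ P : G, π P = d → P ∈ (oflipCM c hc2 g₁ Φ).1) ↔ d ∈ ({r 0, r 3, sr 2} : Finset (DihedralGroup 4)) := by
    intro d
    constructor
    · intro hall
      rcases dihedral_cases_h d with hd | hd | hd | ⟨hd, hd'⟩
      · exact hd
      · exfalso
        have h1 := (hmemg g₁).mp (hall g₁ (by rw [hg₁, hd]))
        apply h1
        constructor
        · intro _; exact Or.inl rfl
        · intro _; rw [hg₁]; decide
      · exfalso
        have h1 := (hmemg (c * g₁ * u₀)).mp (hall (c * g₁ * u₀) (by rw [map_mul, map_mul, hπc, hg₁, hu₀, mul_one, hd]; decide))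
        apply h1
        constructor
        · intro h'; rw [map_mul, map_mul, hπc, hg₁, hu₀, mul_one] at h'; exact absurd h' (by decide)
        · rintro (h' | h')
          · exfalso
            have e : π (c * g₁ * u₀) = π g₁ := by rw [h']
            rw [map_mul, map_mul, hg₁, hu₀, hπc] at e; exact absurd e (by decide)
          · exact absurd (mul_eq_left.mp h') hu₀1
      · exfalso
        obtain ⟨P, hP⟩ := hπ d
        have h1 := (hmemg P).mp (hall P hP)
        apply h1
        constructor
        · intro h'; rw [hP] at h'; exact absurd h' hd
        · rintro (h' | h')
          · rw [h', hg₁] at hP; rw [← hP] at hd; exact absurd (by decide) hd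
          · rw [h', map_mul, hπc, hg₁] at hP; exact absurd hP hd'.symm
    · intro hd P hP
      rw [hmemg]
      intro h'
      have h1 : π P ∈ ({r 0, r 3, sr 1, sr 2} : Finset (DihedralGroup 4)) := by
        rw [hP]
        exact (by decide : ∀ e : DihedralGroup 4, e ∈ ({r 0, r 3, sr 2} : Finset (DihedralGroup 4)) →
          e ∈ ({r 0, r 3, sr 1, sr 2} : Finset (DihedralGroup 4))) d hd
      rcases h'.mp h1 with h2 | h2
      · rw [h2, hg₁] at hP; rw [← hP] at hd; exact absurd hd (by decide)
      · rw [h2, map_mul, hπc, hg₁] at hP; rw [← hP] at hd; exact absurd hd (by decide)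
  have hB : ∀ g : G, rt c g (oflipCM c hc2 q Φ) ≠ oflipCM c hc2 g₁ Φ := by
    intro g E
    refine dihedral_full_fibres_ne (π g) fun d => ?_
    rw [← hFFq, ← hFFg, ← E]
    constructor
    · intro hall P hP
      rw [mem_rt]
      exact hall (P * g) (by rw [map_mul, hP])
    · intro hall P hP
      have e := hall (P * g⁻¹) (by rw [map_mul, map_inv, hP, mul_inv_cancel_right])
      rwa [mem_rt, inv_mul_cancel_right] at e
  -- the frame law
  exact isLeast_card_gfaces_generate_mixed c hc2 hcen T₀ (rt c q T₀) (dq_base π hπc T₀ hT₀ q hq) m hn hH hG hc1 hm2 (j + 1) hkm q rfl hQ₁ hσH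
    T A hTH hTm hAH hAm hTt hAt Φ hΦ hqA hh hh₂ hhh₂ g₁ hg₁T₀ hg₁T₁ hgΦ hκ₂ hκ₁₂ hTex hAex hB

/-- **THE DIHEDRAL LAW, BLOCK FORM: `μ(G, c) = β(G, c) − 2`** for every surjection `π : G ↠ D₄` of a finite `2`-group with `π c = r²` and `|ker π| ≥ 2`
(part XI: `φ₂ + 2 = β`). [folklore] -/
theorem isLeast_card_gfaces_generate_of_dihedral_block {c : G} (hG : IsPGroup 2 G) (hc2 : c * c = 1) (hcen : ∀ x : G, x * c = c * x)
    (π : G →* DihedralGroup 4) (hπ : Function.Surjective π) (hπc : π c = r 2) (hker : 2 ≤ Nat.card π.ker) :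
    IsLeast {n : ℕ | ∃ S : Finset (CMF G c →₀ ℤ), (↑S ⊆ gfaceSet G c hc2) ∧ S.card = n ∧
      hodgeSpan c hc2 ≤ Submodule.span ℤ (pairSet c) ⊔ Submodule.span ℤ (translates c S)} (Fintype.card (Block c) - 2) := by
  have h := fibreTwo_add_two_eq_card_block_of_dihedral_quotient' hG hc2 hcen π hπ hπc
  rw [show Fintype.card (Block c) - 2 = fibreTwo c hc2 by omega]
  exact isLeast_card_gfaces_generate_of_dihedral hG hc2 hcen π hπ hπc hker

/-! ## §3 The kernel-four law without any reflection hypothesis -/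

/-- **THE KERNEL-FOUR LAW, UNCONDITIONAL.**  `G` finite, `c` a central involution, `π : G →* D₄` surjective with `π c = r²` and `|ker π| = 4`:
**`μ(G, c) = φ₂(G, c)`** — part XL needed a reflection lift of order dividing `4`; the rows `ℤ/4 ⋊ ℤ/8` (all reflection lifts of order `8`) are
now included. [folklore] -/
theorem isLeast_card_gfaces_generate_of_dihedral_kernel_four' {c : G} (hc2 : c * c = 1) (hcen : ∀ x : G, x * c = c * x)
    (π : G →* DihedralGroup 4) (hπ : Function.Surjective π) (hπc : π c = r 2) (hker : Nat.card π.ker = 4) :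
    IsLeast {n : ℕ | ∃ S : Finset (CMF G c →₀ ℤ), (↑S ⊆ gfaceSet G c hc2) ∧ S.card = n ∧
      hodgeSpan c hc2 ≤ Submodule.span ℤ (pairSet c) ⊔ Submodule.span ℤ (translates c S)} (fibreTwo c hc2) := by
  classical
  have hG : IsPGroup 2 G := by
    refine IsPGroup.of_card (n := 5) ?_
    have h := card_filter_comap π hπ (univ : Finset (DihedralGroup 4))
    rw [filter_true_of_mem (fun g _ => mem_univ (π g)), card_univ, card_univ, hker] at h
    rw [Nat.card_eq_fintype_card, h]; rfl
  exact isLeast_card_gfaces_generate_of_dihedral hG hc2 hcen π hπ hπc (by omega)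

/-- **THE KERNEL-FOUR LAW, UNCONDITIONAL, BLOCK FORM: `μ(G, c) = β(G, c) − 2`** for `|ker π| = 4`. [folklore] -/
theorem isLeast_card_gfaces_generate_of_dihedral_kernel_four_block' {c : G} (hc2 : c * c = 1) (hcen : ∀ x : G, x * c = c * x)
    (π : G →* DihedralGroup 4) (hπ : Function.Surjective π) (hπc : π c = r 2) (hker : Nat.card π.ker = 4) :
    IsLeast {n : ℕ | ∃ S : Finset (CMF G c →₀ ℤ), (↑S ⊆ gfaceSet G c hc2) ∧ S.card = n ∧
      hodgeSpan c hc2 ≤ Submodule.span ℤ (pairSet c) ⊔ Submodule.span ℤ (translates c S)} (Fintype.card (Block c) - 2) := by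
  classical
  have hG : IsPGroup 2 G := by
    refine IsPGroup.of_card (n := 5) ?_
    have h := card_filter_comap π hπ (univ : Finset (DihedralGroup 4))
    rw [filter_true_of_mem (fun g _ => mem_univ (π g)), card_univ, card_univ, hker] at h
    rw [Nat.card_eq_fintype_card, h]; rfl
  exact isLeast_card_gfaces_generate_of_dihedral_block hG hc2 hcen π hπ hπc (by omega)

end

end Summit.HodgeConjecture.CorCM.Census.CentralSquares
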